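import Summits.PneNP.PneNP.Theorems.PhaseTwinsPolyDepthTwinsAboveAcDefs

/-!
# Route PhaseTwins, crux `PolyDepthTwinsAbove` (stmt-PneNP-2719), line `annealed-cover-twins`:
the annealed port-pattern sums of one cover gadget as sums over typings (milestone M2 of
`stub_annealedPortLaw`, part 1)

An independent set `I` of the cover gadget `gadGraph τ σ` on `ZMod 2 × Fin n'` is the same thing as
a TYPING `t : Fin n' → Bool × Bool` of the indices (`(t x).1` = `(0, x) ∈ I`, `(t x).2` =
`(1, x) ∈ I`; the bijection `typEquiv`), and `I` is independent iff every matching `σ i` of the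
sample and the fixed port matching `τ` are COMPATIBLE with `t`: no matched pair `{x, y}` has `x`
occupied in layer `0` and `y` occupied in layer `1` (`isIndepSet_gadGraph_iff`). Consequently the
annealed restricted partition function `gadG P τ dm lam k` is a finite sum over typings with
prescribed port values of `λ^{#occupied} · #{samples all of whose matchings are compatible}`
(`gadG_eq_sum_typing`), and `gadTot` likewise / as `Σ_k gadG` (`gadTot_eq_sum_typing`,
`gadTot_eq_sum_gadG`); `portType`/`pcount` are the port types / type counts of a pattern. The deck (layer) swap acts on typings by `Prod.swap` and on port patterns
by `k ↦ k ∘ (q ↦ (q.1, q.2 + 1))`; compatibility is swap-invariant (`compat_swap_iff`), whence the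
exact deck symmetry of the annealed law `gadG_shift` and of the mixture law `mixLaw_shift`.
[folklore]
-/

noncomputable section

open scoped Classical BigOperators

namespace Summit.PneNP.PneNP.Cruxes.PolyDepthTwinsAbove.AnnealedCoverTwins

open Finset
open Summit.PneNP.PneNP.Cruxes.PolyDepthTwinsAbove.ParityWiredPorts (occP)
open Literature.Computability.Complexity (hardcoreZOn hardcoreZOn_def sum_hardcoreZOn_fiber)
open Literature.Computability.Complexity.SlyReduction (isIndepSet_coe_finset_iff)
open Literature.Probability.LatticeModels (independencePolynomial)

set_option linter.dupNamespace false

variable {n' κ dm : ℕ}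

/-! ## Samples, typings, independence -/

/-- Membership in the gadget randomness: every coordinate is a perfect matching. -/
theorem mem_GSample {σ : Fin dm → Equiv.Perm (Fin n')} :
    σ ∈ GSample n' dm ↔ ∀ i, (∀ x, σ i (σ i x) = x) ∧ ∀ x, σ i x ≠ x := by
  simp [GSample, fpfInv, Fintype.mem_piFinset]

/-- The two elements of `ZMod 2`. -/
theorem zmod2_eq_zero_or_one (a : ZMod 2) : a = 0 ∨ a = 1 := by
  revert a; decide

/-- The typing of a set of gadget vertices: `x ↦ ((0,x) ∈ I, (1,x) ∈ I)`. -/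
def typOf (I : Finset (ZMod 2 × Fin n')) : Fin n' → Bool × Bool :=
  fun x => (decide ((0, x) ∈ I), decide ((1, x) ∈ I))

/-- The set of gadget vertices of a typing. -/
def setOfTyp (t : Fin n' → Bool × Bool) : Finset (ZMod 2 × Fin n') :=
  univ.filter fun p => (if p.1 = 0 then (t p.2).1 else (t p.2).2) = true

/-- Membership in `setOfTyp`, layer `0`. -/
theorem mem_setOfTyp_zero (t : Fin n' → Bool × Bool) (x : Fin n') :
    ((0 : ZMod 2), x) ∈ setOfTyp t ↔ (t x).1 = true := by
  simp [setOfTyp]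

/-- Membership in `setOfTyp`, layer `1`. -/
theorem mem_setOfTyp_one (t : Fin n' → Bool × Bool) (x : Fin n') :
    ((1 : ZMod 2), x) ∈ setOfTyp t ↔ (t x).2 = true := by
  simp [setOfTyp]

/-- **Vertex sets of the gadget = typings of the indices.** -/
def typEquiv (n' : ℕ) : Finset (ZMod 2 × Fin n') ≃ (Fin n' → Bool × Bool) where
  toFun := typOf
  invFun := setOfTyp
  left_inv I := by
    ext ⟨a, x⟩
    rcases zmod2_eq_zero_or_one a with rfl | rfl
    · rw [mem_setOfTyp_zero]; simp [typOf]
    · rw [mem_setOfTyp_one]; simp [typOf]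
  right_inv t := by
    funext x
    simp only [typOf, mem_setOfTyp_zero, mem_setOfTyp_one, Bool.decide_eq_true]

/-- `typEquiv` unfolds to `typOf`. -/
theorem typEquiv_apply (I : Finset (ZMod 2 × Fin n')) : typEquiv n' I = typOf I := rfl

/-- The size of a vertex set is the number of occupied layer-`0` plus occupied layer-`1` indices. -/
theorem card_eq_typOf (I : Finset (ZMod 2 × Fin n')) :
    I.card = (univ.filter fun x => (typOf I x).1 = true).card +
      (univ.filter fun x => (typOf I x).2 = true).card := by
  have hlayer : ∀ a : ZMod 2, (I.filter fun p => p.1 = a).card = (univ.filter fun x => (a, x) ∈ I).card := by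
    intro a
    rw [← Finset.card_map ⟨fun x : Fin n' => (a, x), fun x y h => (Prod.mk.injEq _ _ _ _ ▸ h).2⟩]
    congr 1
    ext ⟨b, y⟩
    simp only [mem_filter, mem_map, mem_univ, true_and, Function.Embedding.coeFn_mk, Prod.mk.injEq]
    constructor
    · rintro ⟨h, rfl⟩; exact ⟨y, h, rfl, rfl⟩
    · rintro ⟨x, hx, rfl, rfl⟩; exact ⟨hx, rfl⟩
  rw [Finset.card_eq_sum_card_fiberwise (f := Prod.fst) (t := (univ : Finset (ZMod 2)))
    fun _ _ => mem_univ _]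
  have hu : (univ : Finset (ZMod 2)) = {0, 1} := by decide
  rw [hu, Finset.sum_pair (by decide), hlayer, hlayer]
  simp [typOf]

/-- **Independent sets of one cover gadget.** For a sample `σ` of perfect matchings and an involutive
port matching `τ`, `I` is independent in `gadGraph τ σ` iff no matching edge and no `τ`-edge joins
a layer-`0` vertex of `I` to a layer-`1` vertex of `I`. -/
theorem isIndepSet_gadGraph_iff {τ : Equiv.Perm (Fin n')} (hτ : ∀ x, τ (τ x) = x)
    {σ : Fin dm → Equiv.Perm (Fin n')} (hσ : σ ∈ GSample n' dm) (I : Finset (ZMod 2 × Fin n')) :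
    (gadGraph τ σ).IsIndepSet (↑I : Set (ZMod 2 × Fin n')) ↔
      (∀ i x, ((0 : ZMod 2), x) ∈ I → ((1 : ZMod 2), σ i x) ∉ I) ∧
        (∀ x, τ x ≠ x → ((0 : ZMod 2), x) ∈ I → ((1 : ZMod 2), τ x) ∉ I) := by
  rw [mem_GSample] at hσ
  rw [isIndepSet_coe_finset_iff]
  constructor
  · intro h
    refine ⟨fun i x h0 h1 => h _ h0 _ h1 ?_, fun x hx h0 h1 => h _ h0 _ h1 ?_⟩
    · rw [gadGraph_adj]
      refine ⟨by simp, Or.inl ?_⟩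
      show (1 : ZMod 2) = 0 + 1 ∧ x ≠ σ i x ∧ ((∃ j, σ j x = σ i x) ∨ τ x = σ i x)
      exact ⟨by decide, ((hσ i).2 x).symm, Or.inl ⟨i, rfl⟩⟩
    · rw [gadGraph_adj]
      refine ⟨by simp, Or.inl ?_⟩
      show (1 : ZMod 2) = 0 + 1 ∧ x ≠ τ x ∧ ((∃ j, σ j x = τ x) ∨ τ x = τ x)
      exact ⟨by decide, fun h => hx h.symm, Or.inr rfl⟩
  · rintro ⟨h1, h2⟩
    -- no generating edge inside `I`
    have key : ∀ p ∈ I, ∀ q ∈ I, ¬ gadRel τ σ p q := by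
      rintro ⟨a, x⟩ hp ⟨b, y⟩ hq hr
      simp only [gadRel] at hr
      obtain ⟨hb, hxy, hr⟩ := hr
      rcases zmod2_eq_zero_or_one a with rfl | rfl
      · rw [zero_add] at hb
        subst hb
        rcases hr with ⟨i, hi⟩ | hi
        · exact h1 i x hp (hi ▸ hq)
        · exact h2 x (fun h => hxy (h.symm.trans hi)) hp (hi ▸ hq)
      · have hb0 : b = 0 := by rw [hb]; decide
        subst hb0
        rcases hr with ⟨i, hi⟩ | hi
        · have hyx : σ i y = x := by rw [← hi, (hσ i).1]
          exact h1 i y hq (hyx ▸ hp)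
        · have hyx : τ y = x := by rw [← hi, hτ]
          exact h2 y (fun h => hxy (hyx.symm.trans h)) hq (hyx ▸ hp)
    intro p hp q hq hadj
    rw [gadGraph_adj] at hadj
    rcases hadj.2 with h | h
    · exact key p hp q hq h
    · exact key q hq p hp h

/-! ## The annealed sums as sums over typings -/

/-- The port condition of a pattern `k` in terms of the typing. -/
theorem gadPat_eq_iff (P : Fin 2 × Fin κ ↪ Fin n') (I : Finset (ZMod 2 × Fin n')) (k : PortPat κ) :
    gadPat P I = k ↔ ∀ q : Fin 2 × Fin κ, typOf I (P q) = (k (q, 0), k (q, 1)) := by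
  rw [funext_iff]
  constructor
  · intro h q
    have h0 := h (q, 0)
    have h1 := h (q, 1)
    simp only [gadPat] at h0 h1
    simp only [typOf, h0, h1]
  · rintro h ⟨q, a⟩
    have hq := h q
    simp only [typOf, Prod.mk.injEq] at hq
    rcases zmod2_eq_zero_or_one a with rfl | rfl
    · simpa [gadPat] using hq.1
    · simpa [gadPat] using hq.2

/-- The inner sum over the samples, for a fixed vertex set. -/
theorem sum_GSample_ite (P : Fin 2 × Fin κ ↪ Fin n') {τ : Equiv.Perm (Fin n')} (hτ : ∀ x, τ (τ x) = x)
    (lam : ℝ) (k : PortPat κ) (I : Finset (ZMod 2 × Fin n')) :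
    (∑ σ ∈ GSample n' dm,
        if (gadGraph τ σ).IsIndepSet (↑I : Set (ZMod 2 × Fin n')) ∧ gadPat P I = k
        then lam ^ I.card else 0) =
      if (∀ q : Fin 2 × Fin κ, typOf I (P q) = (k (q, 0), k (q, 1))) ∧
          (∀ x, τ x ≠ x → (typOf I x).1 = true → (typOf I (τ x)).2 = false)
      then lam ^ ((univ.filter fun x => (typOf I x).1 = true).card +
              (univ.filter fun x => (typOf I x).2 = true).card) *
            (((GSample n' dm).filter fun σ =>
                ∀ i x, (typOf I x).1 = true → (typOf I (σ i x)).2 = false).card : ℝ)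
      else 0 := by
  have ht : ∀ x y : Fin n', ((typOf I x).1 = true → (typOf I y).2 = false) ↔
      (((0 : ZMod 2), x) ∈ I → ((1 : ZMod 2), y) ∉ I) := by
    intro x y; simp [typOf]
  have hrw : ∀ σ ∈ GSample n' dm,
      (if (gadGraph τ σ).IsIndepSet (↑I : Set (ZMod 2 × Fin n')) ∧ gadPat P I = k
        then lam ^ I.card else 0) =
      if ((∀ q : Fin 2 × Fin κ, typOf I (P q) = (k (q, 0), k (q, 1))) ∧
          (∀ x, τ x ≠ x → (typOf I x).1 = true → (typOf I (τ x)).2 = false)) ∧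
          (∀ i x, (typOf I x).1 = true → (typOf I (σ i x)).2 = false)
        then lam ^ I.card else 0 := by
    intro σ hσ
    refine if_congr ?_ rfl rfl
    rw [isIndepSet_gadGraph_iff hτ hσ, gadPat_eq_iff]
    simp only [ht]
    exact ⟨fun ⟨⟨a, b⟩, c⟩ => ⟨⟨c, b⟩, a⟩, fun ⟨⟨c, b⟩, a⟩ => ⟨⟨a, b⟩, c⟩⟩
  rw [Finset.sum_congr rfl hrw]
  by_cases hc : (∀ q : Fin 2 × Fin κ, typOf I (P q) = (k (q, 0), k (q, 1))) ∧
      (∀ x, τ x ≠ x → (typOf I x).1 = true → (typOf I (τ x)).2 = false)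
  · rw [if_pos hc]
    have h2 : ∀ σ ∈ GSample n' dm,
        (if ((∀ q : Fin 2 × Fin κ, typOf I (P q) = (k (q, 0), k (q, 1))) ∧
            (∀ x, τ x ≠ x → (typOf I x).1 = true → (typOf I (τ x)).2 = false)) ∧
            (∀ i x, (typOf I x).1 = true → (typOf I (σ i x)).2 = false)
          then lam ^ I.card else 0) =
        if (∀ i x, (typOf I x).1 = true → (typOf I (σ i x)).2 = false)
          then lam ^ I.card else 0 := fun σ _ => if_congr (and_iff_right hc) rfl rfl
    rw [Finset.sum_congr rfl h2, Finset.sum_ite, Finset.sum_const_zero, add_zero, Finset.sum_const,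
      nsmul_eq_mul, mul_comm, card_eq_typOf]
  · rw [if_neg hc]
    exact Finset.sum_eq_zero fun σ _ => if_neg fun h => hc h.1

/-- **`G(k)` as a sum over typings (M2).** The annealed restricted partition function of one cover
gadget with port pattern `k` is the sum, over the typings `t` of `Fin n'` that take the values
prescribed by `k` at the ports and are compatible with the port matching `τ`, of
`λ^{#occupied vertices} · #{samples σ all of whose d-1 matchings are compatible with t}`. -/
theorem gadG_eq_sum_typing (P : Fin 2 × Fin κ ↪ Fin n') {τ : Equiv.Perm (Fin n')}
    (hτ : ∀ x, τ (τ x) = x) (dm : ℕ) (lam : ℝ) (k : PortPat κ) :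
    gadG P τ dm lam k =
      ∑ t : Fin n' → Bool × Bool,
        if (∀ q : Fin 2 × Fin κ, t (P q) = (k (q, 0), k (q, 1))) ∧
            (∀ x, τ x ≠ x → (t x).1 = true → (t (τ x)).2 = false)
        then lam ^ ((univ.filter fun x => (t x).1 = true).card +
                (univ.filter fun x => (t x).2 = true).card) *
              (((GSample n' dm).filter fun σ =>
                  ∀ i x, (t x).1 = true → (t (σ i x)).2 = false).card : ℝ)
        else 0 := by
  have h0 : gadG P τ dm lam k = ∑ σ ∈ GSample n' dm, ∑ I : Finset (ZMod 2 × Fin n'),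
      (if (gadGraph τ σ).IsIndepSet (↑I : Set (ZMod 2 × Fin n')) ∧ gadPat P I = k
        then lam ^ I.card else 0) := by
    unfold gadG
    simp only [hardcoreZOn_def]
    exact Finset.sum_congr rfl fun σ _ => Finset.sum_congr rfl fun I _ => by congr
  rw [h0, Finset.sum_comm, Finset.sum_congr rfl fun I _ => sum_GSample_ite P hτ lam k I]
  exact Fintype.sum_equiv (typEquiv n') _ _ fun I => rfl

/-- `gadTot = Σ_k G(k)` (partition of the annealed sum by the port pattern). -/
theorem gadTot_eq_sum_gadG (P : Fin 2 × Fin κ ↪ Fin n') (τ : Equiv.Perm (Fin n')) (dm : ℕ) (lam : ℝ) :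
    gadTot τ dm lam = ∑ k : PortPat κ, gadG P τ dm lam k := by
  unfold gadTot gadG
  rw [Finset.sum_comm]
  refine Finset.sum_congr rfl fun σ _ => ?_
  rw [sum_hardcoreZOn_fiber]

/-- **`gadTot` as a sum over typings**: all typings compatible with `τ`, no port condition. -/
theorem gadTot_eq_sum_typing {τ : Equiv.Perm (Fin n')} (hτ : ∀ x, τ (τ x) = x) (dm : ℕ) (lam : ℝ) :
    gadTot τ dm lam =
      ∑ t : Fin n' → Bool × Bool,
        if (∀ x, τ x ≠ x → (t x).1 = true → (t (τ x)).2 = false)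
        then lam ^ ((univ.filter fun x => (t x).1 = true).card +
                (univ.filter fun x => (t x).2 = true).card) *
              (((GSample n' dm).filter fun σ =>
                  ∀ i x, (t x).1 = true → (t (σ i x)).2 = false).card : ℝ)
        else 0 := by
  -- use the empty port embedding `κ = 0`
  let P0 : Fin 2 × Fin 0 ↪ Fin n' := ⟨fun q => q.2.elim0, fun q => q.2.elim0⟩
  rw [gadTot_eq_sum_gadG P0 τ dm lam]
  have huniq : ∀ k : PortPat 0, k = fun _ => true := fun k => funext fun q => q.1.2.elim0
  have hU : (univ : Finset (PortPat 0)) = {fun _ => true} := by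
    ext k
    simp only [mem_univ, mem_singleton, true_iff]
    exact huniq k
  rw [hU, Finset.sum_singleton, gadG_eq_sum_typing P0 hτ]
  refine Finset.sum_congr rfl fun t _ => ?_
  have hvac : (∀ q : Fin 2 × Fin 0, t (P0 q) = (true, true)) ↔ True :=
    ⟨fun _ => trivial, fun _ q => q.2.elim0⟩
  simp only [hvac, true_and]

/-- The type of the port `q` under the pattern `k`: (layer `0` occupied, layer `1` occupied). -/
def portType (k : PortPat κ) (q : Fin 2 × Fin κ) : Bool × Bool := (k (q, 0), k (q, 1))

/-- `m_s(k)`: the number of ports of type `s` under the pattern `k`. -/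
def pcount (k : PortPat κ) (s : Bool × Bool) : ℕ := (univ.filter fun q => portType k q = s).card

/-! ## Deck symmetry -/

/-- The layer shift of a port pattern (swap the two layers of every port). -/
theorem shift_shift (k : PortPat κ) :
    (fun q : (Fin 2 × Fin κ) × ZMod 2 => (fun q' : (Fin 2 × Fin κ) × ZMod 2 => k (q'.1, q'.2 + 1))
      (q.1, q.2 + 1)) = k := by
  funext q
  simp only
  rw [add_assoc, show (1 : ZMod 2) + 1 = 0 by decide, add_zero]

/-- **Swap invariance of compatibility**: a matching (involution) is compatible with the swapped typing
`Prod.swap ∘ t` iff it is compatible with `t`. -/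
theorem compat_swap_iff {σ : Equiv.Perm (Fin n')} (hσ : ∀ x, σ (σ x) = x) (t : Fin n' → Bool × Bool)
    (S : Fin n' → Prop) (hS : ∀ x, S (σ x) ↔ S x) :
    (∀ x, S x → ((t x).swap).1 = true → ((t (σ x)).swap).2 = false) ↔
      (∀ x, S x → (t x).1 = true → (t (σ x)).2 = false) := by
  simp only [Prod.fst_swap, Prod.snd_swap]
  constructor
  · intro h x hx h1
    have h' := h (σ x) ((hS x).2 hx)
    rw [hσ] at h'
    cases h2 : (t (σ x)).2
    · rfl
    · exact absurd h1 (by rw [h' h2]; exact Bool.false_ne_true)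
  · intro h x hx h2
    have h' := h (σ x) ((hS x).2 hx)
    rw [hσ] at h'
    cases h1 : (t (σ x)).1
    · rfl
    · exact absurd h2 (by rw [h' h1]; exact Bool.false_ne_true)

/-- **Deck symmetry of the annealed law**: `G(k) = G(shift k)`. -/
theorem gadG_shift (P : Fin 2 × Fin κ ↪ Fin n') {τ : Equiv.Perm (Fin n')} (hτ : ∀ x, τ (τ x) = x)
    (dm : ℕ) (lam : ℝ) (k : PortPat κ) :
    gadG P τ dm lam (fun q => k (q.1, q.2 + 1)) = gadG P τ dm lam k := by
  rw [gadG_eq_sum_typing P hτ, gadG_eq_sum_typing P hτ]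
  -- reindex the typings by the swap
  refine Fintype.sum_equiv (Equiv.arrowCongr (Equiv.refl (Fin n')) (Equiv.prodComm Bool Bool)) _ _
    fun t => ?_
  have e1 : ∀ x, (Equiv.arrowCongr (Equiv.refl (Fin n')) (Equiv.prodComm Bool Bool)) t x = (t x).swap :=
    fun x => rfl
  simp only [e1]
  -- the port condition
  have hport : (∀ q : Fin 2 × Fin κ, t (P q) = (k (q, 0 + 1), k (q, 1 + 1))) ↔
      ∀ q : Fin 2 × Fin κ, (t (P q)).swap = (k (q, 0), k (q, 1)) := by
    rw [show (1 : ZMod 2) + 1 = 0 by decide, zero_add]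
    refine forall_congr' fun q => ?_
    constructor
    · intro h; rw [h]; rfl
    · intro h; rw [← Prod.swap_swap (t (P q)), h]; rfl
  -- the compatibility conditions
  have hτc := compat_swap_iff hτ t (fun x => τ x ≠ x) (fun x => by
    constructor
    · intro h hx; exact h (by rw [hx, hx])
    · intro h hx; exact h (by simpa [hτ] using congrArg τ hx))
  have hσc : ∀ σ ∈ GSample n' dm,
      (∀ i x, ((t x).swap).1 = true → ((t (σ i x)).swap).2 = false) ↔
        ∀ i x, (t x).1 = true → (t (σ i x)).2 = false := by
    intro σ hσ
    rw [mem_GSample] at hσ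
    refine forall_congr' fun i => ?_
    have := compat_swap_iff (hσ i).1 t (fun _ => True) (fun _ => Iff.rfl)
    simpa using this
  have hcard : ((GSample n' dm).filter fun σ =>
      ∀ i x, ((t x).swap).1 = true → ((t (σ i x)).swap).2 = false) =
      ((GSample n' dm).filter fun σ => ∀ i x, (t x).1 = true → (t (σ i x)).2 = false) :=
    Finset.filter_congr hσc
  have hE : (univ.filter fun x => ((t x).swap).1 = true).card +
      (univ.filter fun x => ((t x).swap).2 = true).card =
      (univ.filter fun x => (t x).1 = true).card + (univ.filter fun x => (t x).2 = true).card := by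
    simp only [Prod.fst_swap, Prod.snd_swap]; ring
  simp only [hport, hτc, hcard, hE]

/-- The product law of the shifted pattern in phase `s` is the product law in phase `!s`. -/
theorem prodLaw_shift (qp qm : ℝ) (s : Bool) (k : PortPat κ) :
    prodLaw qp qm s (fun q => k (q.1, q.2 + 1)) = prodLaw qp qm (!s) k := by
  unfold prodLaw
  refine Fintype.prod_equiv (Equiv.prodCongr (Equiv.refl _) (Equiv.addRight (1 : ZMod 2))) _ _
    fun q => ?_
  obtain ⟨q, a⟩ := q
  simp only [Equiv.prodCongr_apply, Equiv.coe_refl, Prod.map_apply, id_eq, Equiv.coe_addRight]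
  have hl : layerOcc qp qm s a = layerOcc qp qm (!s) (a + 1) := by
    unfold layerOcc
    rcases zmod2_eq_zero_or_one a with rfl | rfl
    · simp
    · simp [show (1 : ZMod 2) + 1 = 0 by decide]
  rw [hl]

/-- **Deck symmetry of the mixture law**: `mix(shift k) = mix(k)`. -/
theorem mixLaw_shift (qp qm : ℝ) (k : PortPat κ) :
    mixLaw qp qm (fun q => k (q.1, q.2 + 1)) = mixLaw qp qm k := by
  unfold mixLaw
  rw [prodLaw_shift, prodLaw_shift]
  simp only [Bool.not_true, Bool.not_false]
  ring

end Summit.PneNP.PneNP.Cruxes.PolyDepthTwinsAbove.AnnealedCoverTwins
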